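import Summits.CriticalPhenomena.PercolationContinuityZ3.Theorems.PercNearOneGluingNoHeavyRsw3FarVolumeSecondMoment
import Summits.CriticalPhenomena.PercolationContinuityZ3.Theorems.PercNearOneGluingNoHeavyRsw3FarVolumePigeonholeAspect
import Summits.CriticalPhenomena.PercolationContinuityZ3.Theorems.PercNearOneGluingNoHeavyRsw3VolumeHyperscaling
import HarnessLib

/-!
# RSW3 lane (P2, gen 20): AT `p_c(ℤ^d)`, (A2)□ AND TIGHTNESS OF THE ANNULUS CROSSING-CLUSTER COUNT AT ONE ASPECT `C` IMPLY
# 'FAT AT THE IIC SCALE AND AN ARM TO DISTANCE `s(4Ca+1)`' WITH PROBABILITY `≳ π_{p_c}(s(4Ca+1))` — memo V73, Step 2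

builds on p205010 (kernel theorem, internal audit signed; external expert review pending) — NOT used in this file.

Cell `prim-rsw3`, prover seat `prim-rsw3-p2` (gen 20), memo `run/shared/lean/prim/rsw3/P2-RSWLITE.md` §27.
Support file (`--supports stmt-CriticalPhenomena-4575`); no definitions, no named facts, no sorries.

Assembly at `p = p_c(ℤ^d)`, `d ≥ 2`, of the every-`p` chain of parts I–III′ (`…Rsw3FarVolumeTools`, `…Rsw3FarVolumeSecondMoment`,
`…Rsw3FarVolumePigeonholeAspect`).  Under Basu–Sapozhnikov's (A2)□ at aspect `(s, L)` (`Crossing.SetToSetQuasiMultAspectAt d p_c s L ϰ`,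
`2 ≤ s ≤ L`, `ϰ > 0`) the one-arm ratio inequalities (R_lin), (R2) and quasi-multiplicativity (QM) hold (p1 / gen 19), and
`π(s(4Ca+1)) ≥ ϱ₀ π(a)`.  Adding the TIGHTNESS of the number `N(n,Cn)` of open clusters of `Λ(Cn)` crossing `Λ(Cn) ∖ Λ(n)` at ONE
aspect `C ≥ 2` (`Crossing.annulusClusterCount`; at `C = 2` in `d = 3` literally `Crossing.AnnulusClusterCountTight`, which follows from X_B
by the lead's `annulusClusterCountTight_of_critAnnulusNonCrossing`; at any `C` it follows from a uniform annulus-blocking bound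
`P_{p_c}(Λ(n) ↔ ∂ⁱⁿΛ(Cn)) ≤ 1 − δ`, `annulusClusterCount_tight_of_boxCrossing_le`):

* `exists_le_real_farVolume_of_setToSetQuasiMultAspectAt` — WHAT (A2)□ ALONE GIVES: `∃ c > 0 ∀ a ≥ 1 ∀ M ∈ [3a+1, Ka]:
  c ≤ P_{p_c}(c(2a+1)^dπ(a) < #{v ∈ Λ(a) : v ↔ ∂ⁱⁿΛ_v(M) in Λ_v(M)})` (a positive fraction of the IIC-scale volume is joined to distance `M`);
* **`exists_le_real_siteToBoundary_inter_fat_of_setToSetQuasiMultAspectAt`** — **there are `λ, c > 0` with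
  `c · π_{p_c}(M) ≤ P_{p_c}({0 ↔ ∂ⁱⁿΛ(M)} ∩ {λ(2a+1)^d π_{p_c}(a) ≤ #{z ∈ Λ(Ca) : 0 ↔ z in Λ(4Ca)}})`, `M = s(4Ca+1)`, for every
  `a ≥ 1`**: the cluster of the origin is FAT at scale `Ca` (volume `≳ |Λ(a)|π(a)`, certified inside `Λ(4Ca)`) AND reaches distance `M`,
  with probability comparable to the arm alone.  This is the bounded-ratio statement B(C) to which gen 19 reduced the IIC volume
  lower bound (memo §26 addendum 2); the IIC form is in `…Rsw3IICVolumeLower.lean`.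
* `annulusClusterCount_tight_of_boxCrossing_le` — every `p`, `d`: `P(Λ(n) ↔ ∂ⁱⁿΛ(Cn)) ≤ 1 − δ` (`n ≥ 1`) ⇒ `N(n,Cn)` tight (BK).
* `exists_le_real_siteToBoundary_inter_fat_Z3_of_annulusClusterCountTight`, `…_of_critAnnulusNonCrossing` — the `ℤ³` instances at
  `C = 2` under the lane's typed hypotheses `AnnulusClusterCountTight` resp. X_B = `CritAnnulusNonCrossing`.

Why the count hypothesis (memo §27): every ROOTED route to B(C) needs the pointwise three-arm bound `P(0 ↔ x, 0 ↔ ∂Λ(N)) ≳ π(n)π(N)`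
(V68), whose known proofs use either circuits (`d = 2`) or the harmonic average of the explored cluster (Cai–Ding 2024 for the
metric-graph GFF); the UNROOTED route of parts II–III needs only that the far-connected volume of `Λ(a)` is not split among unboundedly
many crossing clusters of `Λ(Ca) ∖ Λ(a)` for one `C`.

References: H. Kesten, Probab. Theory Relat. Fields 73 (1986), Thm. (8) [Kesten1986]; D. Basu, A. Sapozhnikov, ECP 22 (2017) §1
(A2) [BasuSapozhnikov2017ECP]; C. Borgs, J. Chayes, H. Kesten, J. Spencer, Random Structures Algorithms 15 (1999) §1
[BorgsChayesKestenSpencer1999]; M. Aizenman, Nucl. Phys. B 485 (1997) §5 [Aizenman1997]; Z. Cai, J. Ding, arXiv:2412.05709 (2024),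
Thms. 1.3–1.4 (the GFF analogue). [folklore]
-/

noncomputable section

namespace Summit.CriticalPhenomena.PercolationContinuityZ3.Theorems

namespace Rsw3

open MeasureTheory Literature.Probability.LatticeModels Literature.Probability.Percolation
open SurfaceTension Crossing SimpleGraph
open scoped Literature.Probability.Percolation

variable {d : ℕ}

/-! ## The one-arm ratio `π(s(8a+1))/π(a)` is bounded below -/

/-- Under one-arm quasi-multiplicativity with constant `c` at `p_c(ℤ^d)` (`d ≥ 2`): for `1 ≤ a ≤ M ≤ K a` (`K ≥ 1`),
`c·(2d)⁻¹·(4K)^{1−d} · π(a) ≤ π(M)` (QM and the every-aspect annulus window). [cite: Kesten1982, Cor. 5.1]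
[cite: BasuSapozhnikov2017ECP, §1 assumption (A2)] -/
theorem mul_oneArmProb_le_oneArmProb_of_le_mul (hd : 2 ≤ d) {c : ℝ} (hc : 0 < c)
    (hQM : OneArmQuasiMultAt d (criticalProbI d) c) {K a M : ℕ} (hK : 1 ≤ K) (ha : 1 ≤ a) (haM : a ≤ M) (hM : M ≤ K * a) :
    c * (2 * (d : ℝ))⁻¹ * ((1 : ℝ) / (4 * K)) ^ (d - 1) * oneArmProb d (criticalProbI d) a ≤ oneArmProb d (criticalProbI d) M := by
  have hd0 : (0 : ℝ) < d := by exact_mod_cast (by omega : 0 < d)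
  have hK0 : (0 : ℝ) < K := by exact_mod_cast hK
  have ha0 : (0 : ℝ) < a := by exact_mod_cast ha
  have hM0 : (0 : ℝ) < M := by exact_mod_cast (by omega : 0 < M)
  have hqm := hQM a M ha haM
  have hwin := le_real_boxCrossing_criticalProbI_of_le hd ha haM
  have hπa : 0 ≤ oneArmProb d (criticalProbI d) a := measureReal_nonneg
  have hratio : ((1 : ℝ) / (4 * K)) ^ (d - 1) ≤ ((a : ℝ) / (4 * M)) ^ (d - 1) := by
    refine pow_le_pow_left₀ (by positivity) ?_ _
    rw [div_le_div_iff₀ (by positivity) (by positivity)]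
    have : (M : ℝ) ≤ K * a := by exact_mod_cast hM
    nlinarith
  calc c * (2 * (d : ℝ))⁻¹ * ((1 : ℝ) / (4 * K)) ^ (d - 1) * oneArmProb d (criticalProbI d) a
      ≤ c * (2 * (d : ℝ))⁻¹ * ((a : ℝ) / (4 * M)) ^ (d - 1) * oneArmProb d (criticalProbI d) a := by
        refine mul_le_mul_of_nonneg_right (mul_le_mul_of_nonneg_left hratio (by positivity)) hπa
    _ = c * (oneArmProb d (criticalProbI d) a * ((2 * (d : ℝ))⁻¹ * ((a : ℝ) / (4 * M)) ^ (d - 1))) := by ring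
    _ ≤ c * (oneArmProb d (criticalProbI d) a * (bondPercolation (zdGraph d) (criticalProbI d)).real (boxCrossing d a M)) :=
        mul_le_mul_of_nonneg_left (mul_le_mul_of_nonneg_left hwin hπa) hc.le
    _ ≤ oneArmProb d (criticalProbI d) M := hqm

/-! ## What (A2)□ alone gives: a positive fraction of the IIC-scale volume of `Λ(a)` is joined to distance `Ka` -/

open Classical in
/-- **THE FAR-CONNECTED VOLUME AT `p_c(ℤ^d)` UNDER (A2)□ ALONE** (`d ≥ 2`, (A2)□ at `(s,L)`, `ϰ > 0`; any aspect bound `K ≥ 1`): **there is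
`c > 0` such that for all `a ≥ 1` and `3a + 1 ≤ M ≤ K a`,
`c ≤ P_{p_c}(c · (2a+1)^d π_{p_c}(a) < #{v ∈ Λ(a) : v ↔ ∂ⁱⁿΛ_v(M) in Λ_v(M)})`** — with probability bounded below, a positive fraction of the
IIC-scale volume `|Λ(a)|π(a)` of the box consists of sites with an arm to distance `M ≍ a`.  No count hypothesis is used; this is the
unrooted statement that the pigeonhole of part III converts into B(C). [cite: Kesten1986, Thm. (8)] [cite: BasuSapozhnikov2017ECP, §1 assumption (A2)] -/
theorem exists_le_real_farVolume_of_setToSetQuasiMultAspectAt (hd : 2 ≤ d) {s L : ℕ} (hs : 2 ≤ s) (hsL : s ≤ L)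
    {ϰ : ℝ} (hϰ : 0 < ϰ) (h : SetToSetQuasiMultAspectAt d (criticalProbI d) s L ϰ) {K : ℕ} (hK : 1 ≤ K) :
    ∃ c : ℝ, 0 < c ∧ ∀ a M : ℕ, 1 ≤ a → 3 * a + 1 ≤ M → M ≤ K * a →
      c ≤ (bondPercolation (zdGraph d) (criticalProbI d)).real
        {ω | c * (2 * (a : ℝ) + 1) ^ d * oneArmProb d (criticalProbI d) a <
          (((box d a).filter fun v => ω ∈ DCT16.armEvent v M).card : ℝ)} := by
  classical
  have hd1 : 1 ≤ d := by omega
  have hd0 : (0 : ℝ) < d := by exact_mod_cast (by omega : 0 < d)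
  set p := criticalProbI d with hp
  have hpc : 0 < ((criticalProbI d : unitInterval) : ℝ) := by rw [coe_criticalProbI]; exact criticalProb_zd_pos d hd1
  have hπpos : ∀ n : ℕ, 0 < oneArmProb d p n := fun n =>
    (pow_pos hpc n).trans_le (DKT20.pow_le_real_siteToBoundary hd1 p n)
  obtain ⟨c, hc, hQM⟩ := oneArmQuasiMultAt_of_setToSetQuasiMultAspectAt hd hs hsL hϰ h
  have hA : 0 ≤ 2 * (d : ℝ) / c := by positivity
  have hR : ∀ j n : ℕ, 1 ≤ j → j ≤ n →
      oneArmProb d p j * ((j : ℝ) / (4 * n)) ^ (d - 1) ≤ 2 * d / c * oneArmProb d p n :=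
    fun j n hj hjn => oneArmProb_mul_pow_le_of_oneArmQuasiMultAt hd hc hQM hj hjn
  obtain ⟨B, hB, hR2⟩ := exists_oneArmProb_ratio_of_setToSetQuasiMultAspectAt hd hs hsL hϰ h
  set A : ℝ := 2 * d / c with hAdef
  set D : ℝ := (5 : ℝ) ^ d * (A * (4 : ℝ) ^ (d - 1) / oneArmProb d p 1) +
      B / c * (2 * d * A * (48 : ℝ) ^ (d - 1) + (5 : ℝ) ^ d * (A * (4 : ℝ) ^ (d - 1) / oneArmProb d p 1)) with hD
  have hD0 : 0 ≤ D := by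
    have hπ1 := hπpos 1
    have hE0 : 0 ≤ A * (4 : ℝ) ^ (d - 1) / oneArmProb d p 1 := div_nonneg (mul_nonneg hA (pow_nonneg (by norm_num) _)) hπ1.le
    exact add_nonneg (mul_nonneg (pow_nonneg (by norm_num) _) hE0)
      (mul_nonneg (div_nonneg hB.le hc.le) (add_nonneg (mul_nonneg (mul_nonneg (mul_nonneg (by norm_num) hd0.le) hA)
        (pow_nonneg (by norm_num) _)) (mul_nonneg (pow_nonneg (by norm_num) _) hE0)))
  have hK0 : (0 : ℝ) < K := by exact_mod_cast hK
  have hρ0 : 0 < c * (2 * (d : ℝ))⁻¹ * ((1 : ℝ) / (4 * K)) ^ (d - 1) := by positivity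
  set ρ : ℝ := c * (2 * (d : ℝ))⁻¹ * ((1 : ℝ) / (4 * K)) ^ (d - 1) with hρ
  have h1D : 0 < 1 + D := by linarith
  have hc₁ : 0 < min (ρ / 2) (ρ / (4 * (1 + D))) := lt_min (by linarith) (div_pos hρ0 (by linarith))
  refine ⟨min (ρ / 2) (ρ / (4 * (1 + D))), hc₁, fun a M ha hM3 hMK => ?_⟩
  have haM : a ≤ M := by omega
  have hπa := hπpos a
  have hratio : ρ * oneArmProb d p a ≤ oneArmProb d p M :=
    mul_oneArmProb_le_oneArmProb_of_le_mul hd hc hQM hK ha haM hMK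
  have h2 := le_real_lt_card_filter_armEvent hd1 p hpc hA hc hR hR2 hQM ha hM3
  have hScard : ((box d a).card : ℝ) = (2 * (a : ℝ) + 1) ^ d := by rw [card_box]; push_cast; ring
  -- the probability
  have hprob : ρ / (4 * (1 + D)) ≤ (bondPercolation (zdGraph d) p).real
      {ω | ((box d a).card : ℝ) * oneArmProb d p M / 2 < (((box d a).filter fun v => ω ∈ DCT16.armEvent v M).card : ℝ)} := by
    refine le_trans ?_ h2
    have hden : 0 < 4 * (1 + D) * oneArmProb d p a := mul_pos (mul_pos (by norm_num) h1D) hπa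
    have heq : ρ / (4 * (1 + D)) = ρ * oneArmProb d p a / (4 * (1 + D) * oneArmProb d p a) := by
      field_simp
    rw [heq]
    exact div_le_div_of_nonneg_right hratio hden.le
  -- the level: `c (2a+1)^d π(a) ≤ ½ |Λ(a)| π(M)`
  have hlevel : min (ρ / 2) (ρ / (4 * (1 + D))) * (2 * (a : ℝ) + 1) ^ d * oneArmProb d p a ≤
      ((box d a).card : ℝ) * oneArmProb d p M / 2 := by
    rw [hScard]
    have h1 : min (ρ / 2) (ρ / (4 * (1 + D))) * (2 * (a : ℝ) + 1) ^ d * oneArmProb d p a ≤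
        ρ / 2 * (2 * (a : ℝ) + 1) ^ d * oneArmProb d p a :=
      mul_le_mul_of_nonneg_right (mul_le_mul_of_nonneg_right (min_le_left _ _) (by positivity)) hπa.le
    have h2 : ρ / 2 * (2 * (a : ℝ) + 1) ^ d * oneArmProb d p a = (2 * (a : ℝ) + 1) ^ d * (ρ * oneArmProb d p a) / 2 := by ring
    have h3 : (2 * (a : ℝ) + 1) ^ d * (ρ * oneArmProb d p a) / 2 ≤ (2 * (a : ℝ) + 1) ^ d * oneArmProb d p M / 2 :=
      div_le_div_of_nonneg_right (mul_le_mul_of_nonneg_left hratio (by positivity)) (by norm_num)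
    linarith
  calc min (ρ / 2) (ρ / (4 * (1 + D))) ≤ ρ / (4 * (1 + D)) := min_le_right _ _
    _ ≤ _ := hprob
    _ ≤ _ := measureReal_mono fun ω hω => by
        rw [Set.mem_setOf_eq] at hω ⊢
        exact lt_of_le_of_lt hlevel hω

/-! ## B(C): fat at the IIC scale and an arm to distance `s(4Ca+1)` -/

open Classical in
/-- **FAT AT THE IIC SCALE WITH A LONG ARM** (`p_c(ℤ^d)`, `d ≥ 2`; (A2)□ at aspect `(s,L)`, `2 ≤ s ≤ L`, `ϰ > 0`; tightness of the
count `N(n, Cn)` of clusters of `Λ(Cn)` crossing `Λ(Cn) ∖ Λ(n)` at ONE aspect `C ≥ 2`, every `d`): **there are `λ > 0`, `c > 0` such that for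
every `a ≥ 1`, with `M = s(4Ca+1)`:**
**`c · π_{p_c}(M) ≤ P_{p_c}({0 ↔ ∂ⁱⁿΛ(M)} ∩ {λ (2a+1)^d π_{p_c}(a) ≤ #{z ∈ Λ(Ca) : 0 ↔ z in Λ(4Ca)}})`.**
Proof: part II gives `P(½|Λ(a)|π(M) < Z_a) ≥ π(M)/(4(1+D)π(a)) ≥ ϱ₀/(4(1+D))` (`π(M) ≥ ϱ₀π(a)`), tightness at level `ε = ϱ₀/(8(1+D))`
gives `k`, and part III′ (pigeonhole over the clusters of `Λ(Ca)`, re-rooting) converts the difference into the displayed bound with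
`λ = ϱ₀/(2k)`, `c = ϱ₀/(16k(1+D))`. [cite: Kesten1986, Thm. (8)] [cite: BasuSapozhnikov2017ECP, §1 assumption (A2)]
[cite: BorgsChayesKestenSpencer1999, §1 (tightness postulate)] -/
theorem exists_le_real_siteToBoundary_inter_fat_of_setToSetQuasiMultAspectAt (hd : 2 ≤ d) {s L : ℕ} (hs : 2 ≤ s) (hsL : s ≤ L)
    {ϰ : ℝ} (hϰ : 0 < ϰ) (h : SetToSetQuasiMultAspectAt d (criticalProbI d) s L ϰ) {C : ℕ} (hC : 2 ≤ C)
    (hT : ∀ ε : ℝ, 0 < ε → ∃ k : ℕ, ∀ n : ℕ, 1 ≤ n →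
      (bondPercolation (zdGraph d) (criticalProbI d)).real {ω | (k : ℕ∞) < annulusClusterCount d n (C * n) ω} ≤ ε) :
    ∃ lam c : ℝ, 0 < lam ∧ 0 < c ∧ ∀ a : ℕ, 1 ≤ a →
      c * oneArmProb d (criticalProbI d) (s * (4 * (C * a) + 1)) ≤
        (bondPercolation (zdGraph d) (criticalProbI d)).real (siteToBoundary d (s * (4 * (C * a) + 1)) ∩
          {ω : BondConfig (Site d) | lam * (2 * (a : ℝ) + 1) ^ d * oneArmProb d (criticalProbI d) a ≤
            (((box d (C * a)).filter fun w =>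
              ω ∈ (openConnIn (↑(box d (4 * (C * a))) : Set (Site d)) (0 : Site d) w : Set (BondConfig (Site d)))).card : ℝ)}) := by
  classical
  have hd1 : 1 ≤ d := by omega
  have hd0 : (0 : ℝ) < d := by exact_mod_cast (by omega : 0 < d)
  set p := criticalProbI d with hp
  set μ := bondPercolation (zdGraph d) p with hμ
  have hpc : 0 < ((criticalProbI d : unitInterval) : ℝ) := by rw [coe_criticalProbI]; exact criticalProb_zd_pos d hd1
  have hπpos : ∀ n : ℕ, 0 < oneArmProb d p n := fun n =>
    (pow_pos hpc n).trans_le (DKT20.pow_le_real_siteToBoundary hd1 p n)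
  -- the every-`p` inputs at `p_c`
  obtain ⟨c, hc, hQM⟩ := oneArmQuasiMultAt_of_setToSetQuasiMultAspectAt hd hs hsL hϰ h
  have hA : 0 ≤ 2 * (d : ℝ) / c := by positivity
  have hR : ∀ j n : ℕ, 1 ≤ j → j ≤ n →
      oneArmProb d p j * ((j : ℝ) / (4 * n)) ^ (d - 1) ≤ 2 * d / c * oneArmProb d p n :=
    fun j n hj hjn => oneArmProb_mul_pow_le_of_oneArmQuasiMultAt hd hc hQM hj hjn
  obtain ⟨B, hB, hR2⟩ := exists_oneArmProb_ratio_of_setToSetQuasiMultAspectAt hd hs hsL hϰ h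
  -- the constants
  set A : ℝ := 2 * d / c with hAdef
  set D : ℝ := (5 : ℝ) ^ d * (A * (4 : ℝ) ^ (d - 1) / oneArmProb d p 1) +
      B / c * (2 * d * A * (48 : ℝ) ^ (d - 1) + (5 : ℝ) ^ d * (A * (4 : ℝ) ^ (d - 1) / oneArmProb d p 1)) with hD
  have hD0 : 0 ≤ D := by
    have hπ1 := hπpos 1
    have hE0 : 0 ≤ A * (4 : ℝ) ^ (d - 1) / oneArmProb d p 1 := div_nonneg (mul_nonneg hA (pow_nonneg (by norm_num) _)) hπ1.le
    exact add_nonneg (mul_nonneg (pow_nonneg (by norm_num) _) hE0)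
      (mul_nonneg (div_nonneg hB.le hc.le) (add_nonneg (mul_nonneg (mul_nonneg (mul_nonneg (by norm_num) hd0.le) hA)
        (pow_nonneg (by norm_num) _)) (mul_nonneg (pow_nonneg (by norm_num) _) hE0)))
  -- the aspect constant `K = 5 s C` (`M = s(4Ca+1) ≤ K a`)
  set K : ℕ := 5 * s * C with hKdef
  have hK1 : 1 ≤ K := by
    rw [hKdef]; have : 1 * 1 * 1 ≤ 5 * s * C := Nat.mul_le_mul (Nat.mul_le_mul (by norm_num) (by omega)) (by omega); omega
  have hK0 : (0 : ℝ) < K := by exact_mod_cast hK1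
  have hρ0 : 0 < c * (2 * (d : ℝ))⁻¹ * ((1 : ℝ) / (4 * K)) ^ (d - 1) := by positivity
  set ρ : ℝ := c * (2 * (d : ℝ))⁻¹ * ((1 : ℝ) / (4 * K)) ^ (d - 1) with hρ
  have h1D : 0 < 1 + D := by linarith
  obtain ⟨k₀, hk₀⟩ := hT (ρ / (8 * (1 + D))) (div_pos hρ0 (by linarith))
  set k : ℕ := max k₀ 1 with hk
  have hk1 : 1 ≤ k := le_max_right _ _
  have hk0 : (0 : ℝ) < k := by exact_mod_cast hk1
  have hkne : (k : ℝ) ≠ 0 := hk0.ne'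
  have h1Dne : (1 + D) ≠ 0 := h1D.ne'
  refine ⟨ρ / (2 * k), ρ / (16 * k * (1 + D)), div_pos hρ0 (by linarith),
    div_pos hρ0 (mul_pos (by linarith) h1D), fun a ha => ?_⟩
  -- the scales: annulus `Λ(N) ∖ Λ(a)`, `N = Ca`; arm radius `M = s(4N+1)`
  obtain ⟨N, hNdef⟩ : ∃ N : ℕ, N = C * a := ⟨_, rfl⟩
  have h2aN : 2 * a ≤ N := by rw [hNdef]; exact Nat.mul_le_mul_right a hC
  have hNCa : N ≤ C * a := hNdef.le
  rw [← hNdef]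
  set M : ℕ := s * (4 * N + 1) with hMdef
  have hsM : 2 * (4 * N + 1) ≤ M := Nat.mul_le_mul_right _ hs
  have hM3 : 3 * a + 1 ≤ M := by omega
  have hNM : N + a ≤ M := by omega
  have hMK : M ≤ K * a := by
    rw [hMdef, hKdef]
    have h1 : 4 * N + 1 ≤ 5 * (C * a) := by
      have : a ≤ C * a := by nlinarith
      omega
    calc s * (4 * N + 1) ≤ s * (5 * (C * a)) := Nat.mul_le_mul_left s h1
      _ = 5 * s * C * a := by ring
  have haM : a ≤ M := by omega
  have hπa := hπpos a
  have hπM := hπpos M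
  -- `π(M) ≥ ρ π(a)`
  have hratio : ρ * oneArmProb d p a ≤ oneArmProb d p M :=
    mul_oneArmProb_le_oneArmProb_of_le_mul hd hc hQM hK1 ha haM hMK
  -- part II
  have h2 := le_real_lt_card_filter_armEvent hd1 p hpc hA hc hR hR2 hQM ha hM3
  -- the count hypothesis at level `k ≥ k₀`
  have hbad : μ.real {ω | (k : ℕ∞) < annulusClusterCount d a N ω} ≤ ρ / (8 * (1 + D)) := by
    refine le_trans (measureReal_mono fun ω hω => ?_) (hNdef ▸ hk₀ a ha)
    simp only [Set.mem_setOf_eq] at hω ⊢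
    exact lt_of_le_of_lt (by exact_mod_cast le_max_left k₀ 1) hω
  -- part III′
  have h3 := mul_le_card_mul_real_siteToBoundary_inter_fat_of_le p (d := d) ha h2aN hNM hk1
  set S : ℝ := ((box d a).card : ℝ) with hS
  have hSpos : 0 < S := by
    have h : 0 < (box d a).card := by rw [card_box]; exact pow_pos (by omega) d
    rw [hS]; exact_mod_cast h
  have hScard : S = (2 * (a : ℝ) + 1) ^ d := by rw [hS, card_box]; push_cast; ring
  set t : ℝ := S * oneArmProb d p M / (2 * k) with ht
  set P₂ : ℝ := μ.real {ω | S * oneArmProb d p M / 2 <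
      (((box d a).filter fun v => ω ∈ DCT16.armEvent v M).card : ℝ)} with hP₂
  set Pbad : ℝ := μ.real {ω | (k : ℕ∞) < annulusClusterCount d a N ω} with hPbad
  set Q : ℝ := μ.real (siteToBoundary d M ∩
      {ω : BondConfig (Site d) | t ≤ (((box d N).filter fun w =>
        ω ∈ (openConnIn (↑(box d (4 * N)) : Set (Site d)) (0 : Site d) w : Set (BondConfig (Site d)))).card : ℝ)}) with hQ
  -- `P₂ ≥ ρ/(4(1+D))`
  have hP₂ge : ρ / (4 * (1 + D)) ≤ P₂ := by
    refine le_trans ?_ h2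
    have hden : 0 < 4 * (1 + D) * oneArmProb d p a := mul_pos (mul_pos (by norm_num) h1D) hπa
    have heq : ρ / (4 * (1 + D)) = ρ * oneArmProb d p a / (4 * (1 + D) * oneArmProb d p a) := by
      field_simp
    rw [heq]
    exact div_le_div_of_nonneg_right hratio hden.le
  -- `t (P₂ − Pbad) ≤ S Q`, hence `Q ≥ (π(M)/(2k)) ρ/(8(1+D))`
  have h3' : t * (P₂ - Pbad) ≤ S * Q := h3
  have hQge : oneArmProb d p M * (ρ / (16 * k * (1 + D))) ≤ Q := by
    have hdiff : ρ / (8 * (1 + D)) ≤ P₂ - Pbad := by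
      have : ρ / (4 * (1 + D)) - ρ / (8 * (1 + D)) = ρ / (8 * (1 + D)) := by field_simp; ring
      linarith
    have ht0 : 0 ≤ t := div_nonneg (mul_nonneg hSpos.le hπM.le) (by linarith)
    have hSne : S ≠ 0 := hSpos.ne'
    have h4 : t * (ρ / (8 * (1 + D))) ≤ S * Q := (mul_le_mul_of_nonneg_left hdiff ht0).trans h3'
    have h5 : S * (oneArmProb d p M * (ρ / (16 * k * (1 + D)))) = t * (ρ / (8 * (1 + D))) := by
      rw [ht]; field_simp; ring
    exact le_of_mul_le_mul_left (by linarith [h4, h5]) hSpos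
  -- monotonicity of the fat event in the level: `λ (2a+1)^d π(a) ≤ t`
  have hlam : ρ / (2 * k) * (2 * (a : ℝ) + 1) ^ d * oneArmProb d p a ≤ t := by
    rw [ht, hScard]
    have : ρ / (2 * k) * (2 * (a : ℝ) + 1) ^ d * oneArmProb d p a = (2 * (a : ℝ) + 1) ^ d * (ρ * oneArmProb d p a) / (2 * k) := by
      field_simp
    rw [this, div_le_div_iff_of_pos_right (by linarith)]
    exact mul_le_mul_of_nonneg_left hratio (pow_nonneg (by linarith) _)
  calc ρ / (16 * k * (1 + D)) * oneArmProb d p M = oneArmProb d p M * (ρ / (16 * k * (1 + D))) := mul_comm _ _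
    _ ≤ Q := hQge
    _ ≤ _ := by
        refine measureReal_mono (Set.inter_subset_inter_right _ fun ω hω => ?_)
        rw [Set.mem_setOf_eq] at hω ⊢
        exact hlam.trans hω

/-! ## From an annulus-blocking bound to count tightness (every `d`, every `p`) -/

/-- **ANY uniform annulus-blocking bound gives count tightness** (every `p`, every `d`, `C ≥ 1`): if
`P_p(Λ(n) ↔ ∂ⁱⁿΛ(Cn) in Λ(Cn)) ≤ 1 − δ` for all `n ≥ 1` (`δ > 0`), then `P_p(k < N(n, Cn)) ≤ (1−δ)^{k+1}`, so the count is tight — Aizenman's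
BK count bound (lead, `real_le_annulusClusterCount_le_pow`). [cite: Aizenman1997, §3 eq. (3.1)] -/
theorem annulusClusterCount_tight_of_boxCrossing_le (p : unitInterval) {C : ℕ} (hC : 1 ≤ C) {δ : ℝ} (hδ : 0 < δ)
    (hblock : ∀ n : ℕ, 1 ≤ n → (bondPercolation (zdGraph d) p).real (boxCrossing d n (C * n)) ≤ 1 - δ) :
    ∀ ε : ℝ, 0 < ε → ∃ k : ℕ, ∀ n : ℕ, 1 ≤ n →
      (bondPercolation (zdGraph d) p).real {ω | (k : ℕ∞) < annulusClusterCount d n (C * n) ω} ≤ ε := by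
  classical
  intro ε hε
  set μ := bondPercolation (zdGraph d) p with hμ
  have hδ1 : δ ≤ 1 := by
    have h := hblock 1 le_rfl
    linarith [measureReal_nonneg (μ := μ) (s := boxCrossing d 1 (C * 1))]
  obtain ⟨k, hk⟩ := exists_pow_lt_of_lt_one hε (by linarith : 1 - δ < 1)
  refine ⟨k, fun n hn => ?_⟩
  rw [setOf_nat_lt_eq_setOf_succ_le]
  have h1 := real_le_annulusClusterCount_le_pow (d := d) p n (C * n) (k + 1)
  -- the `openConnIn` crossing event has the probability of `boxCrossing d n (Cn)`
  have hcross : μ.real {ω | ∃ x ∈ box d n, ∃ y ∈ innerBoundary (zdGraph d) (box d (C * n)),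
      ω ∈ openConnIn (↑(box d (C * n)) : Set (Site d)) x y} ≤ μ.real (boxCrossing d n (C * n)) := by
    refine DCT16.real_mono_of_forall_subset_edgeSet (zdGraph d) p fun ω hω h => ?_
    exact (mem_cross_iff_mem_boxCrossing (by nlinarith) hω).1 h
  have h2 : μ.real {ω | ∃ x ∈ box d n, ∃ y ∈ innerBoundary (zdGraph d) (box d (C * n)),
      ω ∈ openConnIn (↑(box d (C * n)) : Set (Site d)) x y} ^ (k + 1) ≤ (1 - δ) ^ (k + 1) :=
    pow_le_pow_left₀ measureReal_nonneg (hcross.trans (hblock n hn)) _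
  have h3 : (1 - δ) ^ (k + 1) ≤ (1 - δ) ^ k := pow_le_pow_of_le_one (by linarith) (by linarith) (by omega)
  exact h1.trans (h2.trans (h3.trans hk.le))

/-! ## The `ℤ³` instances under the lane's typed hypotheses -/

open Classical in
/-- **`ℤ³`: (A2)□ + `AnnulusClusterCountTight` ⇒ fat at the IIC scale with a long arm, w.p. `≳ π_{p_c}`** — the typed LANE-4 input
`Crossing.AnnulusClusterCountTight` is exactly the count hypothesis at `d = 3`. [cite: BorgsChayesKestenSpencer1999, §1 (tightness postulate)]
[cite: BasuSapozhnikov2017ECP, §1 assumption (A2)] -/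
theorem exists_le_real_siteToBoundary_inter_fat_Z3_of_annulusClusterCountTight {s L : ℕ} (hs : 2 ≤ s) (hsL : s ≤ L)
    {ϰ : ℝ} (hϰ : 0 < ϰ) (h : SetToSetQuasiMultAspectAt 3 (criticalProbI 3) s L ϰ) (hT : AnnulusClusterCountTight) :
    ∃ lam c : ℝ, 0 < lam ∧ 0 < c ∧ ∀ a : ℕ, 1 ≤ a →
      c * oneArmProb 3 (criticalProbI 3) (s * (4 * (2 * a) + 1)) ≤
        (bondPercolation (zdGraph 3) (criticalProbI 3)).real (siteToBoundary 3 (s * (4 * (2 * a) + 1)) ∩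
          {ω : BondConfig (Site 3) | lam * (2 * (a : ℝ) + 1) ^ 3 * oneArmProb 3 (criticalProbI 3) a ≤
            (((box 3 (2 * a)).filter fun w =>
              ω ∈ (openConnIn (↑(box 3 (4 * (2 * a))) : Set (Site 3)) (0 : Site 3) w : Set (BondConfig (Site 3)))).card : ℝ)}) :=
  exists_le_real_siteToBoundary_inter_fat_of_setToSetQuasiMultAspectAt (d := 3) (by norm_num) hs hsL hϰ h (C := 2) le_rfl hT

open Classical in
/-- **`ℤ³`: (A2)□ + X_B ⇒ fat at the IIC scale with a long arm, w.p. `≳ π_{p_c}`** — X_B (`PercAnnulusCrossing.CritAnnulusNonCrossing`,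
stmt-0846) gives the count tightness with a geometric tail (lead, `annulusClusterCountTight_of_critAnnulusNonCrossing`).
[cite: Aizenman1997, §3 eq. (3.1)] [cite: BasuSapozhnikov2017ECP, §1 assumption (A2)] -/
theorem exists_le_real_siteToBoundary_inter_fat_Z3_of_critAnnulusNonCrossing {s L : ℕ} (hs : 2 ≤ s) (hsL : s ≤ L)
    {ϰ : ℝ} (hϰ : 0 < ϰ) (h : SetToSetQuasiMultAspectAt 3 (criticalProbI 3) s L ϰ)
    (hX : Theses.PercAnnulusCrossing.CritAnnulusNonCrossing) :
    ∃ lam c : ℝ, 0 < lam ∧ 0 < c ∧ ∀ a : ℕ, 1 ≤ a →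
      c * oneArmProb 3 (criticalProbI 3) (s * (4 * (2 * a) + 1)) ≤
        (bondPercolation (zdGraph 3) (criticalProbI 3)).real (siteToBoundary 3 (s * (4 * (2 * a) + 1)) ∩
          {ω : BondConfig (Site 3) | lam * (2 * (a : ℝ) + 1) ^ 3 * oneArmProb 3 (criticalProbI 3) a ≤
            (((box 3 (2 * a)).filter fun w =>
              ω ∈ (openConnIn (↑(box 3 (4 * (2 * a))) : Set (Site 3)) (0 : Site 3) w : Set (BondConfig (Site 3)))).card : ℝ)}) :=
  exists_le_real_siteToBoundary_inter_fat_Z3_of_annulusClusterCountTight hs hsL hϰ h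
    (annulusClusterCountTight_of_critAnnulusNonCrossing hX)

end Rsw3

end Summit.CriticalPhenomena.PercolationContinuityZ3.Theorems
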